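import Mathlib
import HarnessLib

/-!
# Venture HSemireg — the algebraic step of the orbit-lemma proof of the supertrace law (Σ)

HONEST FRAMING. Lean leaf for the computation cell `pub-hsemireg` (theory seat th-3 gen 28; file of
record `run/shared/lean/pub/pub-hsemireg/theory/TH3-SIGMA-ORBIT-PROOF.md`, 2026-08-24). In the
minimal twisted-complex model of a «reduced-point complex» on a smooth threefold germ the degree-one
law (Σ) says `str(u(s') V(s)) = 0` for the odd gluing operators `u` and the odd potentials `V` of a
W-class subject to the Killing relation (E1), in particular `{u(s), V(s)} = 0`. The note proves it
for every amplitude in two steps: (1) an ORBIT LEMMA — by finite representation type of the linear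
quiver `A_{m+1}` (Gabriel), for a generic direction `s` every `u(s')` is tangent to the `GL`-orbit
of `u(s)`, i.e. `u(s') = ξ ∘ u(s) - u(s) ∘ ξ` for a level-preserving (even) `ξ`; (2) a supertrace
identity. THIS FILE kernel-checks step (2) only, in its invariant form on the total space `U`
with the parity operator `σ` (the supertrace of `X` is `trace (σ ∘ X)`): if `σ` anticommutes with
`x`, and `x` anticommutes with `y`, then `trace (σ ∘ (ξ ∘ x - x ∘ ξ) ∘ y) = 0` for EVERY `ξ`.
Step (1), the density argument and the model are NOT formalised; no object is constructed;
nothing here bears on HC, HC_CM or HC_AV.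
-/

namespace Summit.Ventures.HSemireg

open LinearMap

variable {F : Type*} [Field F]
variable {U : Type*} [AddCommGroup U] [Module F U] [FiniteDimensional F U]

/-- **Orbit step of (Σ), trace form.** Let `σ, x, y, ξ` be endomorphisms of a finite-dimensional
space with `σ ∘ x = -(x ∘ σ)` (the parity operator anticommutes with the odd operator `x`) and
`x ∘ y + y ∘ x = 0` (the Killing relation (E1) at one direction). Then the tangent vector
`ξ ∘ x - x ∘ ξ` to the conjugation orbit of `x` pairs to zero with `y` under the supertrace:
`trace (σ ∘ (ξ ∘ x - x ∘ ξ) ∘ y) = 0`. Proof: cyclicity of the trace turns the second term into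
`-trace (σ ∘ ξ ∘ y ∘ x)`, so the sum is `trace (σ ∘ ξ ∘ (x ∘ y + y ∘ x)) = 0`.
(TH3-SIGMA-ORBIT-PROOF §3.) [folklore] -/
theorem trace_parity_orbitTangent_comp_eq_zero (σ x y ξ : U →ₗ[F] U)
    (hσx : σ ∘ₗ x = -(x ∘ₗ σ)) (hxy : x ∘ₗ y + y ∘ₗ x = 0) :
    LinearMap.trace F U (σ ∘ₗ (ξ ∘ₗ x - x ∘ₗ ξ) ∘ₗ y) = 0 := by
  have hyx : y ∘ₗ x = -(x ∘ₗ y) := eq_neg_of_add_eq_zero_right hxy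
  -- the two terms of the expansion have the same trace:
  -- trace (σ x ξ y) = trace ((ξ y) (σ x)) = -trace ((ξ y x) σ) = -trace (σ ξ y x) = trace (σ ξ x y)
  have key : LinearMap.trace F U (σ ∘ₗ x ∘ₗ ξ ∘ₗ y) =
      LinearMap.trace F U (σ ∘ₗ ξ ∘ₗ x ∘ₗ y) := by
    have e1 : σ ∘ₗ x ∘ₗ ξ ∘ₗ y = (σ ∘ₗ x) ∘ₗ (ξ ∘ₗ y) := by
      simp only [LinearMap.comp_assoc]
    have e2 : (ξ ∘ₗ y) ∘ₗ (σ ∘ₗ x) = -((ξ ∘ₗ y ∘ₗ x) ∘ₗ σ) := by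
      rw [hσx, LinearMap.comp_neg]
      simp only [LinearMap.comp_assoc]
    have e3 : σ ∘ₗ (ξ ∘ₗ y ∘ₗ x) = -(σ ∘ₗ ξ ∘ₗ x ∘ₗ y) := by
      simp only [hyx, LinearMap.comp_neg]
    rw [e1, LinearMap.trace_comp_comm', e2, map_neg, LinearMap.trace_comp_comm', e3, map_neg,
      neg_neg]
  have expand : σ ∘ₗ (ξ ∘ₗ x - x ∘ₗ ξ) ∘ₗ y = σ ∘ₗ ξ ∘ₗ x ∘ₗ y - σ ∘ₗ x ∘ₗ ξ ∘ₗ y := by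
    simp only [LinearMap.comp_sub, LinearMap.sub_comp, LinearMap.comp_assoc]
  rw [expand, map_sub, key, sub_self]

/-- **Orbit step of (Σ), the statement used in the note.** With `σ` the parity operator
(`σ ∘ x = -(x ∘ σ)` for the odd `x = u(s)`), `y = V(s)` satisfying the Killing relation
`x ∘ y + y ∘ x = 0`, and `u'` any operator tangent to the conjugation orbit of `x`
(`u' = ξ ∘ x - x ∘ ξ`, which the orbit lemma of TH3-SIGMA-ORBIT-PROOF §2 provides for `u' = u(s')`
at a generic direction `s`), the supertrace `trace (σ ∘ u' ∘ y)` — i.e. `str(u(s') V(s))` —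
vanishes. [folklore] -/
theorem supertrace_orbitTangent_comp_eq_zero (σ x y u' : U →ₗ[F] U)
    (hσx : σ ∘ₗ x = -(x ∘ₗ σ)) (hxy : x ∘ₗ y + y ∘ₗ x = 0)
    (hu' : ∃ ξ : U →ₗ[F] U, u' = ξ ∘ₗ x - x ∘ₗ ξ) :
    LinearMap.trace F U (σ ∘ₗ u' ∘ₗ y) = 0 := by
  obtain ⟨ξ, rfl⟩ := hu'
  exact trace_parity_orbitTangent_comp_eq_zero σ x y ξ hσx hxy

end Summit.Ventures.HSemireg
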